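import Literature.AlgebraicGeometry.AbelianSchemes.AbelianSchemeQuotientPolarizationPullback
import Literature.AlgebraicGeometry.AbelianSchemes.AbelianSchemeDualIsogenyComp
import Literature.AlgebraicGeometry.AbelianSchemes.DualIsogenyMulN
import HarnessLib

/-!
# `ψ ≫ λ_B ≫ ψ^∨ = λ ≫ [n]` for the isogeny quotient — UNCONDITIONAL over a reduced, locally Noetherian base
# ([MumfordAV1970] §23 p. 231, §15 Thm. 1; [MilneAV2008] I §8–§9)

Topic `AlgebraicGeometry/AbelianSchemes`; namespace `Literature.AlgebraicGeometry.AbelianSchemes.AbelianSchemeOver`.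
KERNEL ONLY: theorems; no definition, no named fact, no instance, no `sorry`.

★ `quotientMk_comp_polarizationDesc_comp_dualIsogeny` (p747941) proves the pull-back identity from the two functoriality clauses
`hcomp` (`(ψ ≫ π)^∨ = π^∨ ≫ ψ^∨`) and `hmulN` (`[n]^∨ = [n]`); both are now ★ (B-p05 (g15): `DualPair.dualIsogeny_comp` p747???,
`DualPair.dualIsogeny_mulN` p747612 under the unit hypothesis `hD`, itself ★ for polarisations: `Polarization.nonempty_unitHatSlice_iso`
p747796).  This file discharges them:

* `quotientMk_comp_polarizationDesc_comp_dualIsogeny_of_isReduced` — `ψ ≫ λ_B ≫ ψ^∨ = λ ≫ [n]_Â` over a reduced, locally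
  Noetherian `S`, given the unit hypothesis `hD` for the source dual pair (e.g. from any polarisation of `A`).

## References
* [MumfordAV1970] §23 (p. 231), §15 Thm. 1 (p. 143), §8 (iv) (p. 75).  * [MilneAV2008] I §8 pp. 36–37, §9 Thm. 9.1 (p. 42).
HC_CM is proved only modulo the 7 printed citations until rung 0 closes; this file discharges none of them.
-/

set_option autoImplicit false

noncomputable section

universe u

open CategoryTheory CategoryTheory.Limits AlgebraicGeometry MonoidalCategory CartesianMonoidalCategory
open scoped MonObj

namespace Literature.AlgebraicGeometry.AbelianSchemes

namespace AbelianSchemeOver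

variable {S : Scheme.{u}} (A : AbelianSchemeOver S)
  {Y : Scheme.{u}} (u : S ⟶ Y) (K : Subgroup A.Sections) [IsCommMonObj A.X] {n : ℕ}
  (hK : ∀ σ : K, (σ : A.Sections) ^ n = 1)
  [Finite K] [Y.IsSeparated] [IsSeparated (A.X.hom ≫ u)] [S.IsSeparated]
  (hcov : ∀ x : A.left, ∃ O : (A.translationActionOver u K).StableAffineOpens, x ∈ O.1)
  [LocallyOfFiniteType (A.X.hom ≫ u)] [IsLocallyNoetherian Y]
  (hG : ∃ _ : GrpObj (A.quotientOver u K), IsMonHom (A.quotientMk u K hcov))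
  (hsm : Smooth (A.quotientOver u K).hom) (hgc : GeometricallyConnected (A.quotientOver u K).hom)
  (D : A.DualPair) [IsAffine Y]
  (hfree : ∀ (Ω : Type u) [Field Ω] [IsAlgClosed Ω] (x : Spec (.of Ω) ⟶ A.left) (σ : K), σ ≠ 1 →
    x ≫ (A.translation (σ : A.Sections)).left ≠ x)
  (K' : Subgroup D.hat.Sections) [Finite K'] [IsSeparated (D.hat.X.hom ≫ u)]
  (hcov' : ∀ x : D.hat.left, ∃ O : (D.hat.translationActionOver u K').StableAffineOpens, x ∈ O.1)
  [LocallyOfFiniteType (D.hat.X.hom ≫ u)]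
  (hG' : ∃ _ : GrpObj (D.hat.quotientOver u K'), IsMonHom (D.hat.quotientMk u K' hcov'))
  (hsm' : Smooth (D.hat.quotientOver u K').hom) (hgc' : GeometricallyConnected (D.hat.quotientOver u K').hom)
  (hfree' : ∀ (Ω : Type u) [Field Ω] [IsAlgClosed Ω] (x : Spec (.of Ω) ⟶ D.hat.left) (σ : K'), σ ≠ 1 →
    x ≫ (D.hat.translation (σ : D.hat.Sections)).left ≠ x)
  (Φ : (prodTranslationActionOver (A.quotientBy u K hcov hG hsm hgc) D.hat u K' hcov').EquivariantStructure
    (A.poincarePullback u K hK hcov hG hsm hgc D hfree))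

/-- **`ψ ≫ λ_B ≫ ψ^∨ = λ ≫ [n]_Â`, unconditionally over a reduced, locally Noetherian base** (★ p747941 with its two
functoriality clauses discharged by ★ `DualPair.dualIsogeny_comp` and ★ `DualPair.dualIsogeny_mulN`; the unit hypothesis `hD`
is ★ `Polarization.nonempty_unitHatSlice_iso` for any polarisation of `A`). [cite: MumfordAV1970, §23 (p. 231)]
[cite: MilneAV2008, I §9 Thm. 9.1 (p. 42)] -/
theorem quotientMk_comp_polarizationDesc_comp_dualIsogeny_of_isReduced [IsReduced S] [IsLocallyNoetherian S] (h4)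
    (hD : Nonempty ((Scheme.Modules.pullback (DualPair.unitHatSlice D)).obj D.P ≅ SheafOfModules.unit _))
    (lam : A.X ⟶ D.hat.X)
    (hlam : ∀ σ : K, A.translation (σ : A.Sections) ≫ lam ≫ D.hat.quotientMk u K' hcov' = lam ≫ D.hat.quotientMk u K' hcov') :
    letI : GrpObj (A.quotientOver u K) := (A.quotientBy u K hcov hG hsm hgc).grpObj
    haveI := A.isMonHom_quotientMk u K hcov hG hsm hgc
    (A.quotientMk u K hcov).left ≫ (A.polarizationDesc u K hcov D.hat K' hcov' lam hlam).left ≫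
        @DualPair.dualIsogeny S A (A.quotientBy u K hcov hG hsm hgc) (A.quotientMk u K hcov)
          (A.isMonHom_quotientMk u K hcov hG hsm hgc) D
          (A.dualPairOfQuotientRigidified u K hK hcov hG hsm hgc D hfree K' hcov' hG' hsm' hgc' hfree' Φ h4) =
      lam.left ≫ (D.hat.mulN n).left := by
  letI : GrpObj (A.quotientOver u K) := (A.quotientBy u K hcov hG hsm hgc).grpObj
  haveI := A.isMonHom_quotientMk u K hcov hG hsm hgc
  haveI := A.isMonHom_mulNDesc u K hK hcov hG hsm hgc hfree
  haveI := A.isMonHom_mulN n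
  refine A.quotientMk_comp_polarizationDesc_comp_dualIsogeny u K hK hcov hG hsm hgc D hfree K' hcov' hG' hsm' hgc' hfree' Φ
    h4 lam hlam ?_ ?_
  · exact @DualPair.dualIsogeny_comp S A (A.quotientBy u K hcov hG hsm hgc) A (A.quotientMk u K hcov)
      (A.mulNDesc u K hK hcov) (A.isMonHom_quotientMk u K hcov hG hsm hgc)
      (A.isMonHom_mulNDesc u K hK hcov hG hsm hgc hfree) D
      (A.dualPairOfQuotientRigidified u K hK hcov hG hsm hgc D hfree K' hcov' hG' hsm' hgc' hfree' Φ h4) D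
  · exact DualPair.dualIsogeny_mulN D hD n

end AbelianSchemeOver

end Literature.AlgebraicGeometry.AbelianSchemes

end
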